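import Summits.BirchSwinnertonDyer.BirchSwinnertonDyer.Theorems.ByReductionTypeAtTwoSupersingularFlatLocalDualityMapLambda
import Summits.BirchSwinnertonDyer.BirchSwinnertonDyer.Theorems.ByReductionTypeAtTwoSupersingularFlatPairFun
import Literature.NumberTheory.EllipticCurves.AnticyclotomicSignedCompactSelmer
import HarnessLib

/-!
# Route `ByReductionTypeAtTwo` (rung K4), crux `SupersingularRankZeroAtTwo` (item stmt-BirchSwinnertonDyer-19097), line
# `odd_blind_package` v2.17, stub `stub_flatPackage`, conjunct (8), clause F1♭ — joint J3(v) of the hF1♭-LIM/hF1♭-LEV seam: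
# **FROM THE LAYER LOCAL CONDITION `loc_n s = κ_{U_n}(Q)` TO A KUMMER DATUM OVER `ℚ_∞`**, the ♭-local condition of
# `θ_{n,k}(s)` at `v`, and ORTH READ AT THE LAYER (cell `bsd-2adic`, seat `bsd-2adic-t42` GEN 49; `--supports 19097`, helper)

HONEST FRAMING (D-0054): THEOREMS ONLY — no definition, no named fact, no instance, no notation, no `sorry`.  Helper toward
conjunct (8); closes NO stub; 19097 stays OPEN on its 5 registered stubs (v2.17); nothing is booked; BSD₂ is proved for no
supersingular curve and BSD for no curve by any of this; typed ≠ proved.  Generic prime `p`, generic `ℤ_p`-extension `κ` of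
`ℚ` and finite place `v` (no `p ≠ 2`, no cyclotomic hypothesis, no ×2).

## What and why

The Λ-adic passage `SSFlatPT.exists_snd_coleman_apply_eq_of_levelwise` (file `…FlatPTLimit`, p831689) reduces T-LIM
(«ker toX ⊆ range loc» of conjunct (8)) to the displayed finite-level input (LEV w), which the follow-on hand hF1♭-LEV derives
from ORTH w by the one-place Poitou–Tate converse at `(ℚ_n, p^k)` (`SSFlatPT.pairing_localization_eq_zero_iff_canonical`,
p830701) read through the layer dictionary.  That converse CONSUMES, as its orthogonality hypothesis, the vanishing of `w`
against every class of `H¹_𝓒(ℚ_n, W[p^k])` — classes whose localisation at `v` is the layer Kummer class `κ_{U_n}(Q)` of a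
♭-test point — and ORTH w speaks about Kummer data OVER `ℚ_∞` (cocycle `φ` of a class of `H¹(ℚ_∞, E[p^∞])`, point `Q'` with
`ι_*(φ τ) = τ Q' − Q'` on the local subgroup of `ker κ`).  This file is the bridge between the two currencies (joint J3(v) of the
carrier census, STATUS 2026-08-31), in the tree's LAYER-SUBGROUP vocabulary (`CyclotomicLayer.layerLoc/layerKummer`,
`AcSigned.toInfty` = `θ_{n,k} : H¹(ℚ_n, W[p^k]) → H¹(ℚ_∞, E[p^∞])`, `Sprung2012.sharpFlatLocalKummerOverOfEmb/sharpFlatSelmerInfty`):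

* §1 ★ `exists_kummerDatum_toInfty_of_layerLoc_eq_layerKummer` — if `loc_n s = κ_{U_n}(Q)` in `H¹(U_n, W[p^k]|)` then
  `θ_{n,k}(s)` has a Kummer datum `(φ, Q', k)` at `v` with `p^k • Q' = Q` (pick a cocycle `ψ` of `s` and a root `R` of `Q`;
  the coboundary witness `m ∈ W[p^k]` of `[ψ|_{U_n}] = [κ_R]` is absorbed into the ROOT, `Q' := R + ι_* m`, so that `ψ|` IS the
  Kummer cocycle of `Q'` on the nose).
* §2 `toInfty_mem_sharpFlatLocalKummerOverOfEmb_of_layerLoc_eq_layerKummer` — hence `θ_{n,k}(s)` satisfies Sprung's ♭-local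
  Kummer condition at the chosen place above `v` whenever `Q` is a ♭-test point of level `k` (`p^k ∣ z'(Q)` for all
  `z' ∈ Ker Col♭`); ★ `toZModPow_apply_eq_zero_of_orth_of_layerLoc_eq_layerKummer` — ORTH w (VERBATIM as in the hF1♭-LIM
  interface) + `θ_{n,k}(s) ∈ Sel♭(ℚ_∞)` + `loc_n s = κ_{U_n}(Q)` ⟹ `w(Q) ≡ 0 (mod p^k)`.

What is NOT here (still hF1♭-LEV's): the conjugates clause `∀ σ ∈ Γ_ℚ` of `sharpFlatSelmerInfty` (one orbit `Γ_ℚ = θ(Γ_v)·Γ_n`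
at `v ∣ p`, `LayerPairing.layerLoc_conjMap`/`layerKummer_smul`, `Θ_g`-stability of `Ker Col♭`), the conditions at `ℓ ≠ p` and at
`∞`, and the level-wise Poitou–Tate instance itself (J1).

References: [SilvermanAEC2009] VIII §2 (pp. 190–191); [Kobayashi2003] §2 (p. 4), (7.17)–(7.21) (p. 12), (8.23) (p. 18);
[Sprung2012] Def. 7.9, Lemma 7.10, Def. 7.11 (p. 1503); [GreenbergLNM1716] §1–§2; [HatleyLeiVigni2022] Remark 3.1 (`θ_{n,m}`).
-/

set_option autoImplicit false
-- the Theorems namespace of this sub repeats the summit name by design (D-0017 nested layout)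
set_option linter.dupNamespace false

noncomputable section

open scoped Classical NumberField

namespace Summit.BirchSwinnertonDyer.BirchSwinnertonDyer.Theorems

namespace SSFlatPT

open CategoryTheory NumberField IsDedekindDomain Field WeierstrassCurve ContinuousCohomology
  Literature.NumberTheory.EllipticCurves Literature.NumberTheory.GaloisRepresentations
  Literature.NumberTheory.EllipticCurves.Sprung2012 Literature.NumberTheory.EllipticCurves.Sprung2017
  Literature.NumberTheory.EllipticCurves.Kobayashi2003 Literature.NumberTheory.EllipticCurves.Kato2004
  Literature.NumberTheory.EllipticCurves.Kato2004.EulerSystemValues ZpExtension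

variable (W : WeierstrassCurve ℚ) [W.IsElliptic] {p : ℕ} [Fact p.Prime] (κ : ZpExtension ℚ p)
  (v : HeightOneSpectrum (𝓞 ℚ))

/-! ## §1 From the LAYER local condition `loc_n s = κ_{U_n}(Q)` to a Kummer datum over `ℚ_∞` -/

/-- ★ **A layer class with Kummer localisation has a Kummer datum over `ℚ_∞`.**  Let `s ∈ H¹(ℚ_n, W[p^k])`
(`W.torsionH1Over ((p:ℤ)^k) (κ.layerSubgroup n)`) and `Q ∈ E(ℚ_{n,v})` with `loc_n s = κ_{U_n}(Q)` in `H¹(U_n, W[p^k]|)`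
(`CyclotomicLayer.layerLoc … s = CyclotomicLayer.layerKummer … Q`, `U_n = layerGroup κ v n`).  Then the image
`θ_{n,k}(s) ∈ H¹(ℚ_∞, E[p^∞])` (`AcSigned.toInfty`: restriction to `ker κ`, coefficients `W[p^k] ↪ E[p^∞]`) has a KUMMER
DATUM AT `v` in the sense of `Sprung2012.sharpFlatLocalKummerOverOfEmb` / of the (V̄) clause of file 5: a cocycle `φ` of
`θ_{n,k}(s)` and a point `Q'` with `p^k • Q' = Q` such that `ι_*(φ τ) = τ • Q' − Q'` for every `τ` in the local subgroup of
`ker κ`.  Proof: pick a cocycle `ψ` of `s` and a root `R` of `Q`; `[ψ|_{U_n}] = [κ_R]` gives `m ∈ W[p^k]` with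
`ψ(τ) − κ_R(τ) = τ m − m` on `U_n` (`oneCocycleClass_eq_zero_iff`); the ROOT `Q' := R + ι_* m` (still `p^k • Q' = Q`) has Kummer
cocycle `ψ|` on the nose, so no coboundary correction of `ψ` is needed. [cite: SilvermanAEC2009, VIII §2 (pp. 190–191)]
[cite: Kobayashi2003, §2 (p. 4) and (8.23) (p. 18)] [cite: Sprung2012, Def. 7.9 and Lemma 7.10 (p. 1503)] -/
theorem exists_kummerDatum_toInfty_of_layerLoc_eq_layerKummer (n k : ℕ)
    (s : W.torsionH1Over ((p : ℤ) ^ k) (κ.layerSubgroup n))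
    (Q : localPoints W (v.adicCompletion ℚ))
    (hQ : Q ∈ localLayerPointsOfEmb κ (closureEmb (K := ℚ) (v.adicCompletion ℚ)) W n)
    (h : CyclotomicLayer.layerLoc W (p ^ k) κ v n s =
      CyclotomicLayer.layerKummer W (p ^ k) κ v n ⟨Q, hQ⟩) :
    ∃ (φ : contOneCocycles (discreteTopRep κ.kerSubgroup (W.geomPrimaryTorsion p)))
      (Q' : localPoints W (v.adicCompletion ℚ)),
      oneCocycleClass (discreteTopRep κ.kerSubgroup (W.geomPrimaryTorsion p)) φ = AcSigned.toInfty W p κ n k s ∧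
      (p ^ k) • Q' = Q ∧
      ∀ τ : localSubgroupOfEmb κ.kerSubgroup (closureEmb (K := ℚ) (v.adicCompletion ℚ)),
        pointsMapOfEmb W (closureEmb (K := ℚ) (v.adicCompletion ℚ))
            ((φ.1 (resGalSubgroupOfEmb κ.kerSubgroup _ τ) : W.geomPrimaryTorsion p) : W.geomPoints) =
          (τ : absoluteGaloisGroup (v.adicCompletion ℚ)) • Q' - Q' := by
  have hN : ((p ^ k : ℕ) : ℤ) ≠ 0 := by exact_mod_cast pow_ne_zero k (Fact.out : p.Prime).ne_zero
  -- a cocycle of `s`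
  obtain ⟨ψ, rfl⟩ :=
    oneCocycleClass_surjective (subgroupRep (W.torsionGaloisModule ((p : ℤ) ^ k)).toTopRep (κ.layerSubgroup n)) s
  -- a root `R` of `Q`, and `layerKummer Q = [κ_R]`
  set R : localPoints W (v.adicCompletion ℚ) := W.subgroupZSMulRoot ((p ^ k : ℕ) : ℤ) hN Q with hRdef
  have hroot : ((p ^ k : ℕ) : ℤ) • R = Q := W.zsmul_subgroupZSMulRoot _ hN Q
  have hfix : ((p ^ k : ℕ) : ℤ) • R ∈
      FixedPoints.addSubgroup (CyclotomicLayer.layerGroup κ v n) (localPoints W (v.adicCompletion ℚ)) := by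
    rw [hroot]; exact hQ
  have hK : CyclotomicLayer.layerKummer W (p ^ k) κ v n ⟨Q, hQ⟩ =
      W.subgroupKummerClass ((p ^ k : ℕ) : ℤ) (CyclotomicLayer.layerGroup κ v n) hN R hfix := by
    change W.subgroupKummerMap ((p ^ k : ℕ) : ℤ) (CyclotomicLayer.layerGroup κ v n) hN ⟨Q, hQ⟩ = _
    exact W.subgroupKummerMap_apply_eq _ (CyclotomicLayer.layerGroup κ v n) hN _ R hfix hroot
  -- `layerLoc [ψ] = [ψ|_{U_n}]`
  have hL : CyclotomicLayer.layerLoc W (p ^ k) κ v n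
        (oneCocycleClass (subgroupRep (W.torsionGaloisModule ((p : ℤ) ^ k)).toTopRep (κ.layerSubgroup n)) ψ) =
      oneCocycleClass _ (contOneCocycles.pullback
        (resGalSubgroupOfEmb (κ.layerSubgroup n) (closureEmb (K := ℚ) (v.adicCompletion ℚ)))
        (X := subgroupRep (W.torsionGaloisModule (((p ^ k : ℕ) : ℤ))).toTopRep (κ.layerSubgroup n))
        (Y := subgroupRep (CyclotomicLayer.torsionLocalRep W (p ^ k) v) (CyclotomicLayer.layerGroup κ v n))
        (TopRep.ofHom ⟨ContinuousLinearMap.id ℤ (geomTorsion W (((p ^ k : ℕ) : ℤ))), fun _ => rfl⟩) ψ) := by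
    unfold CyclotomicLayer.layerLoc
    erw [map_oneCocycleClass]
  -- the two classes agree: extract the coboundary witness `m ∈ W[p^k]`
  rw [hL, hK] at h
  unfold WeierstrassCurve.subgroupKummerClass at h
  rw [← sub_eq_zero, ← oneCocycleClass_sub, oneCocycleClass_eq_zero_iff] at h
  obtain ⟨m, hm⟩ := h
  -- the adjusted root `Q' := R + ι_* m`
  refine ⟨contOneCocycles.pullback (subgroupInclusion (κ.kerSubgroup_le_layerSubgroup n))
      (resHomOfEquivariant (subgroupInclusion (κ.kerSubgroup_le_layerSubgroup n))
        (AddSubgroup.inclusion (AcSigned.geomTorsion_zpow_le_geomPrimaryTorsion W p k)) fun _ _ ↦ rfl) ψ,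
    R + pointsMapOfEmb W (closureEmb (K := ℚ) (v.adicCompletion ℚ))
      ((m : geomTorsion W (((p ^ k : ℕ) : ℤ))) : W.geomPoints),
    ?_, ?_, fun τ ↦ ?_⟩
  · -- the class of the pulled-back cocycle is `toInfty [ψ]`
    exact (resH1Hom_oneCocycleClass _ _ _ ψ).symm
  · -- `p^k • Q' = Q`
    have hm0 : ((p ^ k : ℕ) : ℤ) • ((m : geomTorsion W (((p ^ k : ℕ) : ℤ))) : W.geomPoints) = 0 := m.2
    rw [smul_add, ← natCast_zsmul, ← natCast_zsmul, hroot, ← map_zsmul, hm0, map_zero, add_zero]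
  · -- the Kummer cocycle identity on the local subgroup of `ker κ`
    set τ' : CyclotomicLayer.layerGroup κ v n :=
      ⟨(τ : absoluteGaloisGroup (v.adicCompletion ℚ)), κ.kerSubgroup_le_layerSubgroup n τ.2⟩ with hτ'
    set ψloc := contOneCocycles.pullback
        (resGalSubgroupOfEmb (κ.layerSubgroup n) (closureEmb (K := ℚ) (v.adicCompletion ℚ)))
        (X := subgroupRep (W.torsionGaloisModule (((p ^ k : ℕ) : ℤ))).toTopRep (κ.layerSubgroup n))
        (Y := subgroupRep (CyclotomicLayer.torsionLocalRep W (p ^ k) v) (CyclotomicLayer.layerGroup κ v n))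
        (TopRep.ofHom ⟨ContinuousLinearMap.id ℤ (geomTorsion W (((p ^ k : ℕ) : ℤ))), fun _ => rfl⟩) ψ with hψloc
    set kum := W.subgroupKummerCocycle ((p ^ k : ℕ) : ℤ) (CyclotomicLayer.layerGroup κ v n) hN R hfix with hkum
    have hmτ := hm τ'
    change ψloc.1 τ' - kum.1 τ' = _ at hmτ
    rw [sub_eq_iff_eq_add'] at hmτ
    -- the cocycle of `toInfty [ψ]` at `τ` and `ψ|_{U_n}` at `τ'` have the same underlying point
    have hφ : ((((contOneCocycles.pullback (subgroupInclusion (κ.kerSubgroup_le_layerSubgroup n))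
        (resHomOfEquivariant (subgroupInclusion (κ.kerSubgroup_le_layerSubgroup n))
          (AddSubgroup.inclusion (AcSigned.geomTorsion_zpow_le_geomPrimaryTorsion W p k)) fun _ _ ↦ rfl) ψ).1
        (resGalSubgroupOfEmb κ.kerSubgroup _ τ) : W.geomPrimaryTorsion p) : W.geomPoints)) =
        ((ψloc.1 τ' : geomTorsion W (((p ^ k : ℕ) : ℤ))) : W.geomPoints) := rfl
    -- values on points of `E(ℚ̄_v)`
    have hkumval : pointsMapOfEmb W (closureEmb (K := ℚ) (v.adicCompletion ℚ))
        ((kum.1 τ' : geomTorsion W (((p ^ k : ℕ) : ℤ))) : W.geomPoints) =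
        (τ' : absoluteGaloisGroup (v.adicCompletion ℚ)) • R - R :=
      W.pointsMap_subgroupKummerCocycle_apply _ _ hN R hfix τ'
    have hρ : (((subgroupRep (CyclotomicLayer.torsionLocalRep W (p ^ k) v) (CyclotomicLayer.layerGroup κ v n)).ρ τ' m :
          geomTorsion W (((p ^ k : ℕ) : ℤ))) : W.geomPoints) =
        resGalOfEmb (closureEmb (K := ℚ) (v.adicCompletion ℚ)) (τ' : absoluteGaloisGroup (v.adicCompletion ℚ)) •
          ((m : geomTorsion W (((p ^ k : ℕ) : ℤ))) : W.geomPoints) := rfl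
    rw [hφ, hmτ, AddMemClass.coe_add,
      AddSubgroupClass.coe_sub, map_add, map_sub, hkumval, hρ,
      pointsMapOfEmb_smul, smul_add]
    change (τ : absoluteGaloisGroup (v.adicCompletion ℚ)) • R - R + _ = _
    abel

/-! ## §2 Consequences: the ♭-local condition of `θ_{n,k}(s)` at `v`, and ORTH read at the layer -/

variable {ap : ℤ} {g : absoluteGaloisGroup (v.adicCompletion ℚ)} {c : ℕ → localPoints W (v.adicCompletion ℚ)}

/-- **The ♭-local condition at `v` (chosen place, `σ = 1`) of `θ_{n,k}(s)` from the layer condition.**  If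
`loc_n s = κ_{U_n}(Q)` for a ♭-TEST POINT `Q ∈ E(ℚ_{n,v})` of level `k` (`p^k ∣ z'(Q)` for every `z' ∈ Ker Col♭`), then
`θ_{n,k}(s) ∈ H¹(ℚ_∞, E[p^∞])` lies in Sprung's ♭-local Kummer condition
`sharpFlatLocalKummerOverOfEmb … (localTowerPointsOfEmb κ ι W) (Ker Col♭)` at the place of `ℚ_∞` above `v` singled out by `ι`
(§1 supplies the Kummer datum `(φ, Q', k)` with `p^k • Q' = Q`). [cite: Sprung2012, Def. 7.9 and Def. 7.11 (p. 1503)]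
[cite: Kobayashi2003, §2 (p. 4)] -/
theorem toInfty_mem_sharpFlatLocalKummerOverOfEmb_of_layerLoc_eq_layerKummer (n k : ℕ)
    (s : W.torsionH1Over ((p : ℤ) ^ k) (κ.layerSubgroup n))
    (Q : localPoints W (v.adicCompletion ℚ))
    (hQ : Q ∈ localLayerPointsOfEmb κ (closureEmb (K := ℚ) (v.adicCompletion ℚ)) W n)
    (h : CyclotomicLayer.layerLoc W (p ^ k) κ v n s =
      CyclotomicLayer.layerKummer W (p ^ k) κ v n ⟨Q, hQ⟩)
    (htest : ∀ z' ∈ colemanKer κ (closureEmb (K := ℚ) (v.adicCompletion ℚ)) W ap g c .flat,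
      (p : ℤ_[p]) ^ k ∣ z' ⟨Q, localLayerPointsOfEmb_le_localTowerPointsOfEmb κ _ W n hQ⟩) :
    AcSigned.toInfty W p κ n k s ∈
      sharpFlatLocalKummerOverOfEmb W p κ.kerSubgroup (closureEmb (K := ℚ) (v.adicCompletion ℚ))
        (localTowerPointsOfEmb κ (closureEmb (K := ℚ) (v.adicCompletion ℚ)) W)
        (colemanKer κ (closureEmb (K := ℚ) (v.adicCompletion ℚ)) W ap g c .flat) := by
  obtain ⟨φ, Q', hφ, hQ', hτ⟩ := exists_kummerDatum_toInfty_of_layerLoc_eq_layerKummer W κ v n k s Q hQ h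
  have hmem : (p ^ k) • Q' ∈ localTowerPointsOfEmb κ (closureEmb (K := ℚ) (v.adicCompletion ℚ)) W := by
    rw [hQ']; exact localLayerPointsOfEmb_le_localTowerPointsOfEmb κ _ W n hQ
  have hpt : (⟨(p ^ k) • Q', hmem⟩ : localTowerPointsOfEmb κ (closureEmb (K := ℚ) (v.adicCompletion ℚ)) W) =
      ⟨Q, localLayerPointsOfEmb_le_localTowerPointsOfEmb κ _ W n hQ⟩ := Subtype.ext hQ'
  refine ⟨φ, Q', k, hmem, hφ, fun z' hz' ↦ ?_, hτ⟩
  rw [hpt]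
  exact htest z' hz'

/-- ★ **ORTH read at the layer.**  Let `w` satisfy ORTH (its Kummer values on ♭-Selmer data over `ℚ_∞` vanish — the hypothesis
of T-LIM, VERBATIM as displayed by the hF1♭-LIM interface).  If `s ∈ H¹(ℚ_n, W[p^k])` has `θ_{n,k}(s) ∈ Sel♭(ℚ_∞)` and
`loc_n s = κ_{U_n}(Q)` for `Q ∈ E(ℚ_{n,v})`, then `w(Q) ≡ 0 (mod p^k)` — the orthogonality that the levelwise one-place
Poitou–Tate converse (`SSFlatPT.pairing_localization_eq_zero_iff_canonical`) consumes as its hypothesis on the classes of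
`H¹_𝓒(ℚ_n, W[p^k])`, once these are known to restrict into `Sel♭`. [cite: Kobayashi2003, (7.17)–(7.21) (p. 12), (8.23) (p. 18)]
[cite: Sprung2012, Def. 7.9, Def. 7.11 (p. 1503)] -/
theorem toZModPow_apply_eq_zero_of_orth_of_layerLoc_eq_layerKummer
    (w : localTowerPointsOfEmb κ (closureEmb (K := ℚ) (v.adicCompletion ℚ)) W →+ ℤ_[p])
    (hw : ∀ (s : sharpFlatSelmerInfty W κ (closureEmb (K := ℚ) (v.adicCompletion ℚ)) ap g c .flat)
      (φ : contOneCocycles (discreteTopRep κ.kerSubgroup (W.geomPrimaryTorsion p)))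
      (Q : localPoints W (v.adicCompletion ℚ)) (k : ℕ)
      (hQ : (p ^ k) • Q ∈ localTowerPointsOfEmb κ (closureEmb (K := ℚ) (v.adicCompletion ℚ)) W),
      oneCocycleClass (discreteTopRep κ.kerSubgroup (W.geomPrimaryTorsion p)) φ = (s : W.subgroupH1 p κ.kerSubgroup) →
      (∀ τ : localSubgroupOfEmb κ.kerSubgroup (closureEmb (K := ℚ) (v.adicCompletion ℚ)),
        pointsMapOfEmb W (closureEmb (K := ℚ) (v.adicCompletion ℚ))
            ((φ.1 (resGalSubgroupOfEmb κ.kerSubgroup _ τ) : W.geomPrimaryTorsion p) : W.geomPoints) =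
          (τ : absoluteGaloisGroup (v.adicCompletion ℚ)) • Q - Q) →
      PadicInt.toZModPow k (w ⟨(p ^ k) • Q, hQ⟩) = 0)
    (n k : ℕ) (s : W.torsionH1Over ((p : ℤ) ^ k) (κ.layerSubgroup n))
    (hsel : AcSigned.toInfty W p κ n k s ∈
      sharpFlatSelmerInfty W κ (closureEmb (K := ℚ) (v.adicCompletion ℚ)) ap g c .flat)
    (Q : localPoints W (v.adicCompletion ℚ))
    (hQ : Q ∈ localLayerPointsOfEmb κ (closureEmb (K := ℚ) (v.adicCompletion ℚ)) W n)
    (h : CyclotomicLayer.layerLoc W (p ^ k) κ v n s =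
      CyclotomicLayer.layerKummer W (p ^ k) κ v n ⟨Q, hQ⟩) :
    PadicInt.toZModPow k (w ⟨Q, localLayerPointsOfEmb_le_localTowerPointsOfEmb κ _ W n hQ⟩) = 0 := by
  obtain ⟨φ, Q', hφ, hQ', hτ⟩ := exists_kummerDatum_toInfty_of_layerLoc_eq_layerKummer W κ v n k s Q hQ h
  have hmem : (p ^ k) • Q' ∈ localTowerPointsOfEmb κ (closureEmb (K := ℚ) (v.adicCompletion ℚ)) W := by
    rw [hQ']; exact localLayerPointsOfEmb_le_localTowerPointsOfEmb κ _ W n hQ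
  have hpt : (⟨(p ^ k) • Q', hmem⟩ : localTowerPointsOfEmb κ (closureEmb (K := ℚ) (v.adicCompletion ℚ)) W) =
      ⟨Q, localLayerPointsOfEmb_le_localTowerPointsOfEmb κ _ W n hQ⟩ := Subtype.ext hQ'
  rw [← hpt]
  exact hw ⟨_, hsel⟩ φ Q' k hmem hφ hτ

end SSFlatPT

end Summit.BirchSwinnertonDyer.BirchSwinnertonDyer.Theorems

end
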